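import Summits.CriticalPhenomena.SAWScalingLimit.Theorems.SAWDefectDecoherenceBoundaryClosureRZigzagDiscretisationFrontier
import HarnessLib

/-!
# Crux `BoundaryClosureR` (stmt-CriticalPhenomena-14004), line `polygon-parity-squeeze`,
# stub `stub_innerPolygonsOfZigzag` (7b): structure of a set described by zigzag charts

Landing target:
`Summits/CriticalPhenomena/SAWScalingLimit/Theorems/SAWDefectDecoherenceBoundaryClosureRZigzagDiscretisationStructure.lean`
(`--supports stmt-CriticalPhenomena-14004`; building block of the registered stub
`stub_innerPolygonsOfZigzag`, the lattice half of the inner-polygon construction (IP)).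

Consequences of the local description of the inner polygon `P` (carrier `S`) used by the trimmed
discretisation: flat charts `S ∩ ball z (r/2) = halfPlane k z ∩ ball` at `r`-far frontier points,
corner charts `κ c = (k, k', convex?)` of radius `2r` at the corners `c ∈ Cor` (pairwise `≥ 4r`
apart):

* `corner_not_opposite` — the two forms of a corner chart are never opposite (an empty `∩`-chart
  contradicts `c ∈ closure S`; a slit `∪`-chart contradicts the flat chart at the point of the slit at
  distance `3r/2`, which is `r`-far from all corners by the `4r`-separation);
* `level_other_of_ray_inter` / `_union` — a frontier point `z ≠ c` of a corner chart on the line of one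
  form is at level `+(√3/2)‖z - c‖` (convex) / `-(√3/2)‖z - c‖` (reflex) of the other form;
* `halfBall_subset_of_ray_inter` / `_union`, `eq_of_halfBall_subset_chart` — **the flat chart at a
  frontier point of a corner ray has the form of the ray**;
* `segment_subset_frontier_flat` / `_ray_inter` / `_ray_union` — line segments of a flat chart and ray
  segments of a corner chart consist of frontier points;
* `exists_frontier_of_mem` / `exists_frontier_of_not_mem_closure` — nearest frontier points;
  `ball_subset_of_le_infDist`, `le_infDist_compl_of_ball_subset`, `le_infDist_closure_of_disjoint`.

Sources: folklore plane geometry/topology.  No proposition is defined and no named fact is introduced.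
-/

noncomputable section

open scoped ComplexConjugate Topology
open Set Metric Filter
open Literature.Probability.LatticeModels
open Summit.CriticalPhenomena.SAWScalingLimit.Theorems.PolygonParitySqueeze.InnerZigzag
  (level_split level_add_smul halfPlane_eq_of_level_eq_zero)

namespace Summit.CriticalPhenomena.SAWScalingLimit.Theorems.PolygonParitySqueeze.ZigzagDiscretisation

/-! ### 1. Distances to the complement and to the closure -/

/-- A ball of radius at most the distance to the complement lies inside. [folklore] -/
theorem ball_subset_of_le_infDist {S : Set ℂ} {p : ℂ} {t : ℝ} (h : t ≤ infDist p Sᶜ) : ball p t ⊆ S :=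
  (ball_subset_ball h).trans ball_infDist_compl_subset

/-- A ball inside the set bounds the distance to the complement from below. [folklore] -/
theorem le_infDist_compl_of_ball_subset {S : Set ℂ} {p : ℂ} {t : ℝ} (hne : Sᶜ.Nonempty) (h : ball p t ⊆ S) :
    t ≤ infDist p Sᶜ := by
  rw [le_infDist hne]
  intro y hy
  by_contra hlt
  push Not at hlt
  exact hy (h (mem_ball'.2 hlt))

/-- A ball missing the set bounds the distance to the closure from below. [folklore] -/
theorem le_infDist_closure_of_disjoint {S : Set ℂ} {p : ℂ} {t : ℝ} (hne : (closure S).Nonempty)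
    (h : Disjoint (ball p t) S) : t ≤ infDist p (closure S) := by
  rw [le_infDist hne]
  intro y hy
  by_contra hlt
  push Not at hlt
  rw [Metric.mem_closure_iff] at hy
  obtain ⟨b, hb, hyb⟩ := hy (t - dist p y) (by linarith)
  have : b ∈ ball p t := by
    rw [mem_ball]
    calc dist b p ≤ dist b y + dist y p := dist_triangle _ _ _
      _ < (t - dist p y) + dist p y := by rw [dist_comm b y, dist_comm y p]; linarith
      _ = t := by ring
  exact h.le_bot ⟨this, hb⟩

/-- For an open set the frontier lies in the complement. [folklore] -/
theorem frontier_subset_compl {S : Set ℂ} (hS : IsOpen S) : frontier S ⊆ Sᶜ := by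
  rw [hS.frontier_eq]; exact Set.sdiff_subset_compl _ _

/-- **Nearest frontier point from inside**: for `p` in the open set `S` (with `Sᶜ ≠ ∅`) there is a
frontier point at distance `infDist p Sᶜ`. [folklore] -/
theorem exists_frontier_of_mem {S : Set ℂ} (hS : IsOpen S) (hne : Sᶜ.Nonempty) {p : ℂ} (hp : p ∈ S) :
    ∃ w ∈ frontier S, dist p w = infDist p Sᶜ := by
  obtain ⟨y, hy, hd⟩ := hS.isClosed_compl.exists_infDist_eq_dist hne p
  refine ⟨y, ?_, hd.symm⟩
  have hpos : 0 < infDist p Sᶜ := (hS.isClosed_compl.notMem_iff_infDist_pos hne).1 (fun h => h hp)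
  rw [frontier_eq_closure_inter_closure]
  refine ⟨?_, subset_closure hy⟩
  have h1 : y ∈ closure (ball p (infDist p Sᶜ)) := by
    rw [closure_ball p hpos.ne', mem_closedBall, dist_comm, hd]
  exact closure_mono ball_infDist_compl_subset h1

/-- **Nearest frontier point from outside**: for `p ∉ closure S` (`S ≠ ∅`) there is a frontier point
at distance `infDist p (closure S)`. [folklore] -/
theorem exists_frontier_of_not_mem_closure {S : Set ℂ} (hne : S.Nonempty) {p : ℂ} (hp : p ∉ closure S) :
    ∃ w ∈ frontier S, dist p w = infDist p (closure S) := by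
  obtain ⟨y, hy, hd⟩ := isClosed_closure.exists_infDist_eq_dist hne.closure p
  refine ⟨y, ?_, hd.symm⟩
  have hpos : 0 < infDist p (closure S) := (isClosed_closure.notMem_iff_infDist_pos hne.closure).1 hp
  rw [frontier_eq_closure_inter_closure]
  refine ⟨hy, ?_⟩
  have h1 : y ∈ closure (ball p (infDist p (closure S))) := by
    rw [closure_ball p hpos.ne', mem_closedBall, dist_comm, hd]
  refine closure_mono ?_ h1
  intro w hw hwS
  have : w ∈ closure S := subset_closure hwS
  have h2 := infDist_le_dist_of_mem (x := p) this
  rw [mem_ball'] at hw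
  linarith

/-! ### 2. Segments of frontier points -/

/-- **Line segments of a flat chart are frontier segments.** [folklore] -/
theorem segment_subset_frontier_flat {S : Set ℂ} {k : Fin 6} {z z' : ℂ} {R : ℝ}
    (h : S ∩ ball z R = halfPlane k z ∩ ball z R) (hz' : z' ∈ ball z R)
    (hl : ((z' - z) * conj (innerNormal k)).re = 0) : segment ℝ z z' ⊆ frontier S := by
  have hR : 0 < R := lt_of_le_of_lt dist_nonneg (mem_ball.1 hz')
  intro w hw
  have hwB : w ∈ ball z R := (convex_ball z R).segment_subset (mem_ball_self hR) hz' hw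
  rw [segment_eq_image'] at hw
  obtain ⟨t, -, rfl⟩ := hw
  refine mem_frontier_of_line h hwB ?_
  have : (z + t • (z' - z) - z) * conj (innerNormal k) = (t : ℂ) * ((z' - z) * conj (innerNormal k)) := by
    simp only [Complex.real_smul]; ring
  rw [this, Complex.re_ofReal_mul, hl, mul_zero]

/-- Levels along a ray from `c`: at `c + t(z - c)` they are `t` times those at `z`. [folklore] -/
theorem level_ray (n c z : ℂ) (t : ℝ) : ((c + t • (z - c) - c) * conj n).re = t * ((z - c) * conj n).re := by
  have : (c + t • (z - c) - c) * conj n = (t : ℂ) * ((z - c) * conj n) := by simp only [Complex.real_smul]; ring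
  rw [this, Complex.re_ofReal_mul]

/-- **Ray segments of a convex corner chart are frontier segments**: `z` a frontier point in the chart
on the line of `k` at positive level of `k'` (or `k' = k`). [folklore] -/
theorem segment_subset_frontier_ray_inter {S : Set ℂ} {k k' : Fin 6} {c z : ℂ} {R : ℝ}
    (h : S ∩ ball c R = halfPlane k c ∩ halfPlane k' c ∩ ball c R) (hc : c ∈ frontier S) (hzR : z ∈ ball c R)
    (hk : ((z - c) * conj (innerNormal k)).re = 0) (hk' : 0 < ((z - c) * conj (innerNormal k')).re ∨ k' = k) :
    segment ℝ c z ⊆ frontier S := by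
  have hR : 0 < R := lt_of_le_of_lt dist_nonneg (mem_ball.1 hzR)
  intro w hw
  have hwB : w ∈ ball c R := (convex_ball c R).segment_subset (mem_ball_self hR) hzR hw
  rw [segment_eq_image'] at hw
  obtain ⟨t, ⟨ht0, -⟩, rfl⟩ := hw
  rcases ht0.eq_or_lt with rfl | ht
  · simpa using hc
  · have e1 := level_ray (innerNormal k) c z t
    have e2 := level_ray (innerNormal k') c z t
    rcases hk' with hk' | rfl
    · exact mem_frontier_of_ray_inter h hwB (by rw [e1, hk, mul_zero]) (by rw [e2]; positivity)
    · rw [inter_self] at h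
      exact mem_frontier_of_line h hwB (by rw [e1, hk, mul_zero])

/-- **Ray segments of a reflex corner chart are frontier segments**: `z` in the chart on the line of `k`
at non-positive level of `k'`. [folklore] -/
theorem segment_subset_frontier_ray_union {S : Set ℂ} {k k' : Fin 6} {c z : ℂ} {R : ℝ}
    (h : S ∩ ball c R = (halfPlane k c ∪ halfPlane k' c) ∩ ball c R) (hzR : z ∈ ball c R)
    (hk : ((z - c) * conj (innerNormal k)).re = 0) (hk' : ((z - c) * conj (innerNormal k')).re ≤ 0) :
    segment ℝ c z ⊆ frontier S := by
  have hR : 0 < R := lt_of_le_of_lt dist_nonneg (mem_ball.1 hzR)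
  intro w hw
  have hwB : w ∈ ball c R := (convex_ball c R).segment_subset (mem_ball_self hR) hzR hw
  rw [segment_eq_image'] at hw
  obtain ⟨t, ⟨ht0, -⟩, rfl⟩ := hw
  have e1 := level_ray (innerNormal k) c z t
  have e2 := level_ray (innerNormal k') c z t
  exact mem_frontier_of_ray_union h hwB (by rw [e1, hk, mul_zero])
    (by rw [e2]; exact mul_nonpos_of_nonneg_of_nonpos ht0 hk')

/-! ### 3. The other level on a ray; the flat chart along a ray -/

/-- **On a ray of a convex corner chart the other level is `+(√3/2)‖z - c‖`.** [folklore] -/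
theorem level_other_of_ray_inter {S : Set ℂ} {k k' : Fin 6} {c z : ℂ} {R : ℝ}
    (h : S ∩ ball c R = halfPlane k c ∩ halfPlane k' c ∩ ball c R)
    (hg : (innerNormal k * conj (innerNormal k')).re ≠ -1) (hkk : k' ≠ k)
    (hz : z ∈ frontier S) (hzR : z ∈ ball c R) (hzc : z ≠ c) (hk : ((z - c) * conj (innerNormal k)).re = 0) :
    ((z - c) * conj (innerNormal k')).re = Real.sqrt 3 / 2 * ‖z - c‖ := by
  have hcross : (Complex.I * innerNormal k * conj (innerNormal k')).re = Real.sqrt 3 / 2 ∨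
      (Complex.I * innerNormal k * conj (innerNormal k')).re = -(Real.sqrt 3 / 2) := by
    rcases inner_innerNormal_cases k k' with ⟨-, h1⟩ | h1 | ⟨-, h1⟩
    · exact absurd h1.symm hkk
    · exact absurd h1 hg
    · exact h1
  have habs := abs_level_of_level_eq_zero k k' hk hcross
  rcases frontier_of_inter_chart h hz hzR with ⟨-, h2⟩ | ⟨h2, -⟩
  · rw [abs_of_nonneg h2] at habs; exact habs
  · rw [h2, abs_zero] at habs
    have : ‖z - c‖ = 0 := by
      have h3 : 0 < Real.sqrt 3 / 2 := by positivity
      nlinarith [norm_nonneg (z - c)]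
    exact absurd (sub_eq_zero.1 (norm_eq_zero.1 this)) hzc

/-- **On a ray of a reflex corner chart the other level is `-(√3/2)‖z - c‖`.** [folklore] -/
theorem level_other_of_ray_union {S : Set ℂ} {k k' : Fin 6} {c z : ℂ} {R : ℝ}
    (h : S ∩ ball c R = (halfPlane k c ∪ halfPlane k' c) ∩ ball c R)
    (hg : (innerNormal k * conj (innerNormal k')).re ≠ -1) (hkk : k' ≠ k)
    (hz : z ∈ frontier S) (hzR : z ∈ ball c R) (hzc : z ≠ c) (hk : ((z - c) * conj (innerNormal k)).re = 0) :
    ((z - c) * conj (innerNormal k')).re = -(Real.sqrt 3 / 2 * ‖z - c‖) := by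
  have hcross : (Complex.I * innerNormal k * conj (innerNormal k')).re = Real.sqrt 3 / 2 ∨
      (Complex.I * innerNormal k * conj (innerNormal k')).re = -(Real.sqrt 3 / 2) := by
    rcases inner_innerNormal_cases k k' with ⟨-, h1⟩ | h1 | ⟨-, h1⟩
    · exact absurd h1.symm hkk
    · exact absurd h1 hg
    · exact h1
  have habs := abs_level_of_level_eq_zero k k' hk hcross
  rcases frontier_of_union_chart h hz hzR with ⟨-, h2⟩ | ⟨h2, -⟩
  · rw [abs_of_nonpos h2] at habs; linarith
  · rw [h2, abs_zero] at habs
    have : ‖z - c‖ = 0 := by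
      have h3 : 0 < Real.sqrt 3 / 2 := by positivity
      nlinarith [norm_nonneg (z - c)]
    exact absurd (sub_eq_zero.1 (norm_eq_zero.1 this)) hzc

/-- **A small half-ball of the ray's form at a ray point of a convex corner chart lies in `S`.**
[folklore] -/
theorem halfBall_subset_of_ray_inter {S : Set ℂ} {k k' : Fin 6} {c z : ℂ} {R : ℝ}
    (h : S ∩ ball c R = halfPlane k c ∩ halfPlane k' c ∩ ball c R) (hzR : z ∈ ball c R)
    (hk : ((z - c) * conj (innerNormal k)).re = 0) (hk' : 0 < ((z - c) * conj (innerNormal k')).re ∨ k' = k) :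
    ∃ ε > 0, halfPlane k z ∩ ball z ε ⊆ S := by
  have hgap : 0 < R - dist z c := by rw [mem_ball] at hzR; linarith
  rcases hk' with hk' | hkk
  · refine ⟨min (((z - c) * conj (innerNormal k')).re) (R - dist z c), lt_min hk' hgap, fun w hw => ?_⟩
    obtain ⟨hw1, hw2⟩ := hw
    rw [mem_ball] at hw2
    have hwR : w ∈ ball c R := by
      rw [mem_ball]
      calc dist w c ≤ dist w z + dist z c := dist_triangle _ _ _
        _ < (R - dist z c) + dist z c := by linarith [min_le_right (((z - c) * conj (innerNormal k')).re) (R - dist z c)]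
        _ = R := by ring
    have : w ∈ S ∩ ball c R := by
      rw [h]
      refine ⟨⟨?_, ?_⟩, hwR⟩
      · rw [mem_halfPlane_iff_level, level_split (innerNormal k) w c z, hk, add_zero]
        exact (mem_halfPlane_iff_level k z w).1 hw1
      · rw [mem_halfPlane_iff_level, level_split (innerNormal k') w c z]
        have h1 := abs_level_le_dist k' z w
        have h2 := neg_abs_le ((w - z) * conj (innerNormal k')).re
        linarith [min_le_left (((z - c) * conj (innerNormal k')).re) (R - dist z c)]
    exact this.1
  · rw [hkk, inter_self] at h
    refine ⟨R - dist z c, hgap, fun w hw => ?_⟩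
    obtain ⟨hw1, hw2⟩ := hw
    rw [mem_ball] at hw2
    have hwR : w ∈ ball c R := by
      rw [mem_ball]
      calc dist w c ≤ dist w z + dist z c := dist_triangle _ _ _
        _ < R := by linarith
    have : w ∈ S ∩ ball c R := by
      rw [h]
      refine ⟨?_, hwR⟩
      rw [mem_halfPlane_iff_level, level_split (innerNormal k) w c z, hk, add_zero]
      exact (mem_halfPlane_iff_level k z w).1 hw1
    exact this.1

/-- **A small half-ball of the ray's form at a ray point of a reflex corner chart lies in `S`.**
[folklore] -/
theorem halfBall_subset_of_ray_union {S : Set ℂ} {k k' : Fin 6} {c z : ℂ} {R : ℝ}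
    (h : S ∩ ball c R = (halfPlane k c ∪ halfPlane k' c) ∩ ball c R) (hzR : z ∈ ball c R)
    (hk : ((z - c) * conj (innerNormal k)).re = 0) : ∃ ε > 0, halfPlane k z ∩ ball z ε ⊆ S := by
  have hgap : 0 < R - dist z c := by rw [mem_ball] at hzR; linarith
  refine ⟨R - dist z c, hgap, fun w hw => ?_⟩
  obtain ⟨hw1, hw2⟩ := hw
  rw [mem_ball] at hw2
  have hwR : w ∈ ball c R := by
    rw [mem_ball]
    calc dist w c ≤ dist w z + dist z c := dist_triangle _ _ _
      _ < R := by linarith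
  have : w ∈ S ∩ ball c R := by
    rw [h]
    refine ⟨Or.inl ?_, hwR⟩
    rw [mem_halfPlane_iff_level, level_split (innerNormal k) w c z, hk, add_zero]
    exact (mem_halfPlane_iff_level k z w).1 hw1
  exact this.1

/-- **The flat chart at a point with an inner half-ball of form `k` has form `k`.** [folklore] -/
theorem eq_of_halfBall_subset_chart {S : Set ℂ} {k j : Fin 6} {z : ℂ} {R' : ℝ} (hR' : 0 < R')
    (hsub : ∃ ε > 0, halfPlane k z ∩ ball z ε ⊆ S) (h : S ∩ ball z R' = halfPlane j z ∩ ball z R') : j = k := by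
  obtain ⟨ε, hε, hεS⟩ := hsub
  symm
  refine eq_of_halfPlane_inter_ball_subset (lt_min hε hR') (z := z) (R := min ε R') fun w hw => ?_
  have hw' : w ∈ S ∩ ball z R' :=
    ⟨hεS ⟨hw.1, ball_subset_ball (min_le_left _ _) hw.2⟩, ball_subset_ball (min_le_right _ _) hw.2⟩
  rw [h] at hw'
  exact hw'.1

/-- The flat chart at a collinear nearby point has the same form (flat version). [folklore] -/
theorem eq_of_flat_charts {S : Set ℂ} {k j : Fin 6} {z z' : ℂ} {R R' : ℝ} (hR' : 0 < R')
    (h : S ∩ ball z R = halfPlane k z ∩ ball z R) (hz' : z' ∈ ball z R)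
    (hl : ((z' - z) * conj (innerNormal k)).re = 0) (h' : S ∩ ball z' R' = halfPlane j z' ∩ ball z' R') : j = k := by
  refine eq_of_halfBall_subset_chart hR' ?_ h'
  have hgap : 0 < R - dist z' z := by rw [mem_ball] at hz'; linarith
  refine ⟨R - dist z' z, hgap, fun w hw => ?_⟩
  obtain ⟨hw1, hw2⟩ := hw
  rw [mem_ball] at hw2
  have hwR : w ∈ ball z R := by
    rw [mem_ball]
    calc dist w z ≤ dist w z' + dist z' z := dist_triangle _ _ _
      _ < R := by linarith
  have : w ∈ S ∩ ball z R := by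
    rw [h]
    refine ⟨?_, hwR⟩
    rw [halfPlane_eq_of_level_eq_zero k hl]
    exact hw1
  exact this.1

/-! ### 4. Corner charts are never degenerate slits -/

/-- Inner products of the normals never vanish. [folklore] -/
theorem inner_innerNormal_ne_zero (j k : Fin 6) : (innerNormal j * conj (innerNormal k)).re ≠ 0 := by
  rcases inner_innerNormal_cases j k with ⟨h, -⟩ | h | ⟨h | h, -⟩ <;> rw [h] <;> norm_num

/-- **The two forms of a corner chart are never opposite.**  `Cor` the corners (pairwise `≥ 4r` apart,
on the frontier), flat charts at `r`-far frontier points, corner charts `κ` of radius `2r`.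
[folklore] -/
theorem corner_not_opposite {S : Set ℂ} {Cor : Finset ℂ} {κ : ℂ → Fin 6 × Fin 6 × Bool} {r : ℝ} (hr : 0 < r)
    (hCor : ∀ c ∈ Cor, c ∈ frontier S)
    (hsep : ∀ c ∈ Cor, ∀ c' ∈ Cor, c ≠ c' → 4 * r ≤ dist c c')
    (hflat : ∀ z ∈ frontier S, (∀ c ∈ Cor, r ≤ dist z c) → ∃ k : Fin 6, S ∩ ball z (r / 2) = halfPlane k z ∩ ball z (r / 2))
    (Hκ : ∀ c ∈ Cor, ((κ c).2.2 = true ∧ S ∩ ball c (2 * r) = halfPlane (κ c).1 c ∩ halfPlane (κ c).2.1 c ∩ ball c (2 * r)) ∨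
      ((κ c).2.2 = false ∧ S ∩ ball c (2 * r) = (halfPlane (κ c).1 c ∪ halfPlane (κ c).2.1 c) ∩ ball c (2 * r)))
    {c : ℂ} (hc : c ∈ Cor) : (innerNormal (κ c).1 * conj (innerNormal (κ c).2.1)).re ≠ -1 := by
  intro hopp
  have hneg := innerNormal_eq_neg_of_inner _ _ hopp
  set k := (κ c).1 with hk
  set k' := (κ c).2.1 with hk'
  have hlev : ∀ w : ℂ, ((w - c) * conj (innerNormal k')).re = -((w - c) * conj (innerNormal k)).re := by
    intro w; rw [hneg, map_neg, mul_neg, Complex.neg_re]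
  have hcF := hCor c hc
  rcases Hκ c hc with ⟨-, hch⟩ | ⟨-, hch⟩
  · -- empty convex chart: contradicts `c ∈ closure S`
    have hcl : c ∈ closure S := frontier_subset_closure hcF
    rw [Metric.mem_closure_iff] at hcl
    obtain ⟨b, hb, hcb⟩ := hcl (2 * r) (by positivity)
    have : b ∈ S ∩ ball c (2 * r) := ⟨hb, by rw [mem_ball, dist_comm]; exact hcb⟩
    rw [hch] at this
    obtain ⟨⟨h1, h2⟩, -⟩ := this
    rw [mem_halfPlane_iff_level] at h1 h2
    rw [hlev] at h2
    linarith
  · -- slit: contradicts the flat chart at `z = c + (3r/2) i n_k`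
    set z : ℂ := c + (((3 * r / 2 : ℝ) : ℂ) * Complex.I) * innerNormal k with hz
    have hzc : z - c = (((3 * r / 2 : ℝ) : ℂ) * Complex.I) * innerNormal k := by rw [hz]; ring
    have hnz : ‖z - c‖ = 3 * r / 2 := by
      rw [hzc, norm_mul, norm_mul, norm_innerNormal, Complex.norm_I, Complex.norm_real,
        Real.norm_of_nonneg (by positivity)]; ring
    have hlk : ((z - c) * conj (innerNormal k)).re = 0 := by
      rw [hzc, show (((3 * r / 2 : ℝ) : ℂ) * Complex.I) * innerNormal k * conj (innerNormal k) =
        ((3 * r / 2 : ℝ) : ℂ) * Complex.I * (innerNormal k * conj (innerNormal k)) by ring, Complex.mul_conj,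
        Complex.normSq_eq_norm_sq, norm_innerNormal]
      simp
    have hzB : z ∈ ball c (2 * r) := by rw [mem_ball, dist_eq_norm, hnz]; linarith
    have hzF : z ∈ frontier S := mem_frontier_of_ray_union hch hzB hlk (by rw [hlev, hlk, neg_zero])
    -- `z` is `r`-far from all corners
    have hfar : ∀ c' ∈ Cor, r ≤ dist z c' := by
      intro c' hc'
      by_cases hcc : c = c'
      · subst hcc; rw [dist_eq_norm, hnz]; linarith
      · have := hsep c hc c' hc' hcc
        have h1 : dist c c' ≤ dist c z + dist z c' := dist_triangle _ _ _
        have h2 : dist c z = 3 * r / 2 := by rw [dist_comm, dist_eq_norm, hnz]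
        linarith
    obtain ⟨j, hj⟩ := hflat z hzF hfar
    -- the test point `w = z - (r/4) n_j`
    set w : ℂ := z + ((-(r / 4) : ℝ) : ℂ) * innerNormal j with hw
    have hwz : dist w z = r / 4 := by
      rw [hw, dist_eq_norm, add_sub_cancel_left, norm_mul, norm_innerNormal, Complex.norm_real, Real.norm_eq_abs,
        abs_of_neg (by linarith)]; ring
    have hwball : w ∈ ball z (r / 2) := by rw [mem_ball, hwz]; linarith
    have hwB : w ∈ ball c (2 * r) := by
      rw [mem_ball]
      calc dist w c ≤ dist w z + dist z c := dist_triangle _ _ _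
        _ = r / 4 + 3 * r / 2 := by rw [hwz, dist_eq_norm, hnz]
        _ < 2 * r := by linarith
    have hwj : w ∉ halfPlane j z := by
      rw [mem_halfPlane_iff_level, hw, level_add_real_mul_innerNormal_self, sub_self, zero_mul, Complex.zero_re]
      linarith
    -- `w ∈ S` since its level against `n_k` is non-zero
    have hwk : ((w - c) * conj (innerNormal k)).re = -(r / 4) * (innerNormal j * conj (innerNormal k)).re := by
      rw [level_split (innerNormal k) w c z, hlk, add_zero, hw, level_add_real_mul_innerNormal, sub_self, zero_mul,
        Complex.zero_re, zero_add]
    have hne := inner_innerNormal_ne_zero j k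
    have hwS : w ∈ S := by
      have : w ∈ (halfPlane k c ∪ halfPlane k' c) ∩ ball c (2 * r) := by
        refine ⟨?_, hwB⟩
        rw [mem_union, mem_halfPlane_iff_level, mem_halfPlane_iff_level, hlev, hwk]
        rcases lt_or_gt_of_ne hne with h1 | h1
        · left; nlinarith
        · right; nlinarith
      rw [← hch] at this
      exact this.1
    have : w ∈ S ∩ ball z (r / 2) := ⟨hwS, hwball⟩
    rw [hj] at this
    exact hwj this.1

/-- **Corner charts are never degenerate slits / empty** (registered form, sub-goal of
`stub_innerPolygonsOfZigzag`). [folklore] -/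
theorem zd_corner_not_opposite : ∀ (S : Set ℂ) (Cor : Finset ℂ) (κ : ℂ → Fin 6 × Fin 6 × Bool) (r : ℝ), 0 < r → (∀ c ∈ Cor, c ∈ frontier S) → (∀ c ∈ Cor, ∀ c' ∈ Cor, c ≠ c' → 4 * r ≤ dist c c') → (∀ z ∈ frontier S, (∀ c ∈ Cor, r ≤ dist z c) → ∃ k : Fin 6, S ∩ Metric.ball z (r / 2) = halfPlane k z ∩ Metric.ball z (r / 2)) → (∀ c ∈ Cor, ((κ c).2.2 = true ∧ S ∩ Metric.ball c (2 * r) = halfPlane (κ c).1 c ∩ halfPlane (κ c).2.1 c ∩ Metric.ball c (2 * r)) ∨ ((κ c).2.2 = false ∧ S ∩ Metric.ball c (2 * r) = (halfPlane (κ c).1 c ∪ halfPlane (κ c).2.1 c) ∩ Metric.ball c (2 * r))) → ∀ c ∈ Cor, (innerNormal (κ c).1 * (starRingEnd ℂ) (innerNormal (κ c).2.1)).re ≠ -1 :=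
  fun _ _ _ _ hr hCor hsep hflat Hκ _ hc => corner_not_opposite hr hCor hsep hflat Hκ hc

end Summit.CriticalPhenomena.SAWScalingLimit.Theorems.PolygonParitySqueeze.ZigzagDiscretisation

end
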